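import Summits.AnomalousDissipation.AnomalousDissipation.Theorems.MarginalStabilityChainStrainedLayerLawSumRuleLine
import Literature.Analysis.UnboundedOperators.HeatExtensionDecay
import HarnessLib

/-!
# Crux `MarginalStabilityChain.StrainedLayerLaw` (stmt-AnomalousDissipation-3007), line `FirstLemmasR2K4`
# (parallel relaxation of `x`-independent perturbations): CLASS TOOLS (registered stub `stub_parallelClassTools`)

Support file (`--supports stmt-AnomalousDissipation-3007`). Three elementary tools of the parallel-relaxation
package (the lead's checked skeleton `ParallelRelax`, stub C):

* §1 an ADMISSIBLE `x`-INDEPENDENT perturbation is a compactly supported `C²` shear: `IsAdmissible L θ₁ θ₂` and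
  `θᵢ(x, y) = θᵢ(0, y)` force `θ₂ ≡ 0` (the divergence constraint reduces to `∂_yθ₂ = 0`, and `θ₂` vanishes far
  out) and `θ₁(0, ·) ∈ C²_c(ℝ)` (`admissible_xIndependent`);
* §2 the DISSIPATION SLICE OF A PARALLEL FLOW: `layerDissipation ν L ((x, y) ↦ U y) 0 = ofReal (ν ∫ (U′)²)`
  whenever `(U′)²` is integrable, `L > 0`, `ν ≥ 0` (`layerDissipation_parallel`; the shape of
  `layerDissipation_burgersShearLayer` of `StretchedLayerNSBurgers`);
* §3 the CALORIC EXTENSION OF COMPACTLY SUPPORTED CONTINUOUS DATA VANISHES AT `±∞` on the real line: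
  `heatExtension g σ → 0` along `atTop` and `atBot` for `σ > 0` (`heatExtension_tendsto_zero_atTop_atBot`), from
  the weighted decay `‖x‖·‖(G_σ ⋆ g)(x)‖ ≤ C` of `HeatExtensionDecay` (`exists_pow_mul_norm_heatExtension_le`).

No definitions; the registered stub `stub_parallelClassTools` (the conjunction of §1–§3) closes the file.
References: `…SumRuleLine.lean` (`IsAdmissible`), `Literature/Analysis/FluidPDE/StretchedLayerNS.lean`
(`layerDissipation`, `dX`, `dY`), `Literature/Analysis/UnboundedOperators/HeatExtensionDecay.lean`.
-/

noncomputable section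

open scoped Topology ENNReal
open Filter Set Function MeasureTheory

-- `Summit.<Summit>.<Problem>` is the tree's mandated summit-side namespace (CONVENTIONS §2); for this
-- single-conjunct summit the two coincide, so the duplicate is deliberate.
set_option linter.dupNamespace false

namespace Summit.AnomalousDissipation.AnomalousDissipation.Theorems.StrainedLayerLaw.ParallelRelax

open Literature.Analysis.FluidPDE Literature.Analysis.FluidPDE.StretchedLayer
open Literature.Analysis.UnboundedOperators
open Summit.AnomalousDissipation.AnomalousDissipation.Theorems.StrainedLayerLaw.StrainWorkSumRule

/-! ## §1 Admissible `x`-independent perturbations -/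

/-- **An admissible `x`-independent perturbation is a compactly supported `C²` shear.** If `θ = (θ₁, θ₂)` is
admissible of period `L` (`IsAdmissible`) and `x`-independent, then `θ₂ ≡ 0`, and `θ₁ 0 ∈ C²(ℝ)` has compact
support: the divergence constraint `∂ₓθ₁ + ∂_yθ₂ = 0` loses its first term, so each slice `θ₂ x ·` is a
differentiable function with zero derivative, hence constant, and it vanishes at `y = |R|`; `θ₁ 0` is the slice of
a `C²` map and vanishes off `[-|R|, |R|]`. [folklore] -/
theorem admissible_xIndependent (L : ℝ) (θ₁ θ₂ : ℝ → ℝ → ℝ) (hθ : IsAdmissible L θ₁ θ₂)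
    (hx : ∀ x y, θ₁ x y = θ₁ 0 y ∧ θ₂ x y = θ₂ 0 y) :
    (∀ x y, θ₂ x y = 0) ∧ ContDiff ℝ 2 (θ₁ 0) ∧ HasCompactSupport (θ₁ 0) := by
  obtain ⟨h1, h2, -, ⟨R, hR⟩, hdiv⟩ := hθ
  have hRabs : R ≤ |(|R|)| := by rw [abs_abs]; exact le_abs_self R
  refine ⟨fun x y => ?_, h1.comp (contDiff_const.prodMk contDiff_id), ?_⟩
  · -- the slice `θ₂ x ·` is differentiable with zero derivative, hence constant, and vanishes at `|R|`
    have hdiff : Differentiable ℝ (fun s => θ₂ x s) :=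
      (h2.comp (contDiff_const.prodMk contDiff_id)).differentiable (by norm_num)
    have hzero : ∀ s, deriv (fun s => θ₂ x s) s = 0 := fun s => by
      have h := hdiv x s
      have hc : (fun r => θ₁ r s) = fun _ => θ₁ 0 s := funext fun r => (hx r s).1
      rwa [hc, deriv_const, zero_add] at h
    rw [is_const_of_deriv_eq_zero hdiff hzero y |R|]
    exact (hR x |R| hRabs).2
  · refine HasCompactSupport.intro (K := Icc (-|R|) |R|) isCompact_Icc fun y hy => ?_
    refine (hR 0 y ?_).1
    rw [mem_Icc, not_and_or, not_le, not_le] at hy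
    rcases hy with hy | hy
    · calc R ≤ |R| := le_abs_self R
        _ ≤ -y := by linarith
        _ ≤ |y| := neg_le_abs y
    · calc R ≤ |R| := le_abs_self R
        _ ≤ y := hy.le
        _ ≤ |y| := le_abs_self y

/-! ## §2 The dissipation slice of a parallel flow -/

/-- **Dissipation slice of a parallel flow.** For `u(x, y) = U(y)`, `v = 0`, `L > 0`, `ν ≥ 0` and `(U′)²`
integrable: `layerDissipation ν L u 0 = ofReal (ν ∫ (U′)²)` (`∂ₓu = 0`, `∂_yu = U′`, the zero field has zero
slice derivatives, and the `x`-integral over one period contributes the factor `L`). [folklore] -/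
theorem layerDissipation_parallel (ν L : ℝ) (U : ℝ → ℝ) (hν : 0 ≤ ν) (hL : 0 < L)
    (hint : Integrable (fun y => deriv U y ^ 2)) :
    layerDissipation ν L (fun _ y => U y) (fun _ _ => 0) = ENNReal.ofReal (ν * ∫ y, deriv U y ^ 2) := by
  have hJ : 0 ≤ ∫ y, deriv U y ^ 2 := integral_nonneg fun y => sq_nonneg _
  have hlin : ∫⁻ y, ENNReal.ofReal (deriv U y ^ 2) = ENNReal.ofReal (∫ y, deriv U y ^ 2) :=
    (ofReal_integral_eq_lintegral_ofReal hint (Eventually.of_forall fun _ => sq_nonneg _)).symm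
  have hdX : ∀ x y, dX (fun _ y => U y) x y = 0 := fun x y => by simp [dX]
  have hdY : ∀ x y, dY (fun _ y => U y) x y = deriv U y := fun x y => rfl
  rw [layerDissipation_def]
  simp only [hdX, hdY, dX_const, dY_const, Pi.zero_apply, ne_eq, OfNat.ofNat_ne_zero, not_false_eq_true,
    zero_pow, add_zero, zero_add]
  rw [hlin, setLIntegral_const, Real.volume_Ioc, sub_zero, ← ENNReal.ofReal_mul hJ,
    ← ENNReal.ofReal_mul (div_nonneg hν hL.le)]
  congr 1
  field_simp

/-! ## §3 The caloric extension of compactly supported data vanishes at `±∞` -/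

/-- **The caloric extension of compactly supported continuous data vanishes at `±∞`** (real line, `σ > 0`):
`heatExtension g σ x → 0` as `x → +∞` and as `x → −∞`, squeezed by `‖(G_σ ⋆ g)(x)‖ ≤ C/‖x‖` from the weighted
decay `‖x‖·‖(G_σ ⋆ g)(x)‖ ≤ C` (`exists_pow_mul_norm_heatExtension_le`, `k = 1`). [folklore] -/
theorem heatExtension_tendsto_zero_atTop_atBot (g : ℝ → ℝ) (σ : ℝ) (hg : Continuous g)
    (hc : HasCompactSupport g) (hσ : 0 < σ) :
    Tendsto (heatExtension g σ) atTop (𝓝 0) ∧ Tendsto (heatExtension g σ) atBot (𝓝 0) := by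
  obtain ⟨C, -, hC⟩ := exists_pow_mul_norm_heatExtension_le hg hc hσ 1
  have key : ∀ x : ℝ, x ≠ 0 → ‖heatExtension g σ x‖ ≤ C / ‖x‖ := fun x hx => by
    have h := hC x
    rw [pow_one] at h
    rw [le_div_iff₀ (norm_pos_iff.mpr hx), mul_comm]
    exact h
  have hnorm : Tendsto (norm : ℝ → ℝ) atBot atTop := tendsto_abs_atBot_atTop
  have htop : Tendsto (fun x : ℝ => C / ‖x‖) atTop (𝓝 0) := tendsto_const_nhds.div_atTop tendsto_norm_atTop_atTop
  have hbot : Tendsto (fun x : ℝ => C / ‖x‖) atBot (𝓝 0) := tendsto_const_nhds.div_atTop hnorm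
  constructor
  · refine squeeze_zero_norm' ?_ htop
    filter_upwards [eventually_gt_atTop (0 : ℝ)] with x hx using key x hx.ne'
  · refine squeeze_zero_norm' ?_ hbot
    filter_upwards [eventually_lt_atBot (0 : ℝ)] with x hx using key x hx.ne

/-! ## The registered stub -/

/-- **Stub C of the parallel-relaxation package (`stub_parallelClassTools`).** The conjunction of
`admissible_xIndependent` (an admissible `x`-independent perturbation is `(g(y), 0)` with `g = θ₁ 0 ∈ C²_c`),
`layerDissipation_parallel` (the dissipation slice of a parallel flow is `ofReal (ν ∫ (U′)²)`) and
`heatExtension_tendsto_zero_atTop_atBot` (`e^{σΔ}g → 0` at `±∞` for compactly supported continuous `g`).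
[folklore] -/
theorem stub_parallelClassTools :
    (∀ (L : ℝ) (θ₁ θ₂ : ℝ → ℝ → ℝ), IsAdmissible L θ₁ θ₂ → (∀ x y, θ₁ x y = θ₁ 0 y ∧ θ₂ x y = θ₂ 0 y) →
      (∀ x y, θ₂ x y = 0) ∧ ContDiff ℝ 2 (θ₁ 0) ∧ HasCompactSupport (θ₁ 0)) ∧
    (∀ (ν L : ℝ) (U : ℝ → ℝ), 0 ≤ ν → 0 < L → Integrable (fun y => deriv U y ^ 2) →
      layerDissipation ν L (fun _ y => U y) (fun _ _ => 0) = ENNReal.ofReal (ν * ∫ y, deriv U y ^ 2)) ∧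
    (∀ (g : ℝ → ℝ) (σ : ℝ), Continuous g → HasCompactSupport g → 0 < σ →
      Tendsto (heatExtension g σ) atTop (𝓝 0) ∧ Tendsto (heatExtension g σ) atBot (𝓝 0)) :=
  ⟨admissible_xIndependent, layerDissipation_parallel, heatExtension_tendsto_zero_atTop_atBot⟩

end Summit.AnomalousDissipation.AnomalousDissipation.Theorems.StrainedLayerLaw.ParallelRelax
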